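import Literature.Computability.QuantumComplexity.InfluenceBounds
import HarnessLib

/-!
# Crux `PseudoBoundedAA` (stmt-QuantumAdvantage-15237) — the COMPLETELY-BOUNDED CORNER, part 1:
# Escudero Gutiérrez's finite-dimensional creation/annihilation contractions

The one published polynomial-rate case of the Aaronson–Ambainis conjecture that is proved by evaluating the polynomial
on MATRICES — Bansal–Sinha–de Wolf (CCC 2022, Thm. 1.3/1.4: completely bounded block-multilinear forms have
`maxInf ≥ Var²/poly(d)`), in Escudero Gutiérrez's short proof (arXiv:2304.06713, Thm. 1.8, Eq. (23)) which uses
EXPLICIT FINITE-DIMENSIONAL real contractions instead of free probability — brought into the kernel, def-free.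

This file is the construction.  Fix coefficients `c : Finset (Fin N) → ℝ` (the Walsh coefficients of a cube
function), a level `D ≥ 1`, and `M > 0` with `Σ_{|S| = D, S ∋ j} c_S² ≤ M` for every variable `j` (e.g. the largest
level-`D` influence).  On the real Hilbert space with orthonormal basis `{v} ∪ {f_T : T ⊆ [N]}` let `A_j` be the
matrix that CREATES from the vacuum `v` the normalised column `Σ_{|T| = D−1, j ∉ T} (c_{T ∪ {j}}/√M) f_T` and
ANNIHILATES `j` on the small states (`f_T ↦ f_{T ∖ {j}}` for `j ∈ T`, `|T| ≤ D − 1`; everything else `↦ 0`).  Then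
(`exists_witness_option`): every `A_j` is a contraction (creation and annihilation have ranges in different
cardinalities, so `‖A_j w‖² = (w_v)²·Inf_j^{=D}/M + Σ_{T ∋ j,|T| ≤ D−1} w_T² ≤ ‖w‖²`), and for every `S` the ordered
product `A_{s₁} A_{s₂} ⋯ A_{s_k}` (`s₁ < ⋯ < s_k` the elements of `S`; the right-most factor acts first and creates,
the others annihilate) has vacuum-to-`f_∅` matrix element `[ |S| = D ] · c_S/√M`, whence
`⟨f_∅, (Σ_S c_S A_{s₁}⋯A_{s_k}) v⟩ = (Σ_{|S| = D} c_S²)/√M`.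
Part 2 (`…CompletelyBoundedCorner`) transports this to `Fin m`, and derives: if the ORDERED COMPLETELY BOUNDED NORM of
`p` is `≤ K` (`⟨f, p(A) v⟩ ≤ K` for all contractions `A_j ∈ M_m(ℝ)` and unit `v, f`, `p(A) := Σ_S p̂(S) A_{s₁}⋯A_{s_k}` —
for a block-multilinear form with increasing blocks this is literally `‖p‖_cb` of Bansal–Sinha–de Wolf / Escudero
Gutiérrez Eq. (19)) then `maxᵢ Infᵢ[p] ≥ 4·Var[p]²/(deg² K²)`, i.e. PB-AA holds on this corner with the card's SHARP
exponent pair `(2, 2)` and `C = 1/K²`.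

Honest label: a published special case (BSdW22 / EG23) in kernel form, `--supports` the open crux; it is NOT KNOWN
to cover `Q_T` (acceptance probabilities are characterised by the SYMMETRISED Fourier cb-norm `‖·‖_{fcb,2T} ≤ 1` with
Boolean behaviour, EG23 Thm. 1.4 — a different functional from the ordered evaluation used here; AA on
`{‖p‖_{fcb,d} ≤ 1}` is EG23 Conj. 1.5, open; whether the ordered cb-norm is polynomially bounded on `Q_T` or `K_T`
is not decided in the tree), and it closes no stub, crux or summit.
Sources: EscuderoGutierrez2023 (arXiv:2304.06713) Thm. 1.8 and its proof (pp. 12–15, Eq. (21)–(23));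
BansalSinhaDeWolf2022 (arXiv:2203.00212) Thm. 1.3, Thm. 1.4; ODonnell2014 §1.4, §2.2.
-/

-- D-0017: single-conjunct summit ⇒ the duplicate `QuantumAdvantage.QuantumAdvantage` is mandated.
set_option linter.dupNamespace false

noncomputable section

open Finset Matrix

namespace Summit.QuantumAdvantage.QuantumAdvantage.Theorems.SosSandwich.CompletelyBoundedCorner

variable {N : ℕ}

/-- Re-indexing a sum over the sets NOT containing `j` by `T ↦ insert j T` gives the sum over the sets
containing `j`. [folklore] -/
theorem sum_filter_notMem_insert (j : Fin N) (g : Finset (Fin N) → ℝ) :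
    ∑ T with j ∉ T, g (insert j T) = ∑ T with j ∈ T, g T := by
  classical
  refine Finset.sum_nbij' (fun T => insert j T) (fun T => T.erase j) ?_ ?_ ?_ ?_ ?_
  · intro T hT
    simp only [Finset.mem_filter, Finset.mem_univ, true_and] at hT ⊢
    exact Finset.mem_insert_self j T
  · intro T hT
    simp only [Finset.mem_filter, Finset.mem_univ, true_and] at hT ⊢
    exact Finset.notMem_erase j T
  · intro T hT
    simp only [Finset.mem_filter, Finset.mem_univ, true_and] at hT
    exact Finset.erase_insert hT
  · intro T hT
    simp only [Finset.mem_filter, Finset.mem_univ, true_and] at hT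
    exact Finset.insert_erase hT
  · intro T _; rfl

/-- **The creation/annihilation contractions (Escudero Gutiérrez's finite-dimensional witness), on the index set
`Option (Finset (Fin N))`.**  For coefficients `c`, a level `D ≥ 1` and `M > 0` dominating every level-`D`
influence `Σ_{|S| = D, S ∋ j} c_S²`, there are matrices `A_j` (all contractions for the Euclidean norm) and unit
vectors `v` (the vacuum) and `f` (`= f_∅`) with
`⟨f, (Σ_S c_S · A_{s₁} ⋯ A_{s_k}) v⟩ = (Σ_{|S| = D} c_S²) / √M`, the products taken in increasing order of the
variables `s₁ < ⋯ < s_k` of `S`.  `A_j` CREATES from the vacuum the superposition `Σ_{|T| = D−1, j ∉ T}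
(c_{T ∪ {j}}/√M) f_T` and ANNIHILATES `j` on the states `f_T`, `|T| ≤ D − 1` (`f_T ↦ f_{T ∖ {j}}` if `j ∈ T`,
else `0`). [cite: EscuderoGutierrez2023, Thm. 1.8 (proof, Eq. (23))] [cite: BansalSinhaDeWolf2022, Thm. 1.4] -/
theorem exists_witness_option (c : Finset (Fin N) → ℝ) {D : ℕ} (hD : 1 ≤ D) {M : ℝ} (hM : 0 < M)
    (hMb : ∀ j : Fin N, ∑ S with (S.card = D ∧ j ∈ S), c S ^ 2 ≤ M) :
    ∃ (A : Fin N → Matrix (Option (Finset (Fin N))) (Option (Finset (Fin N))) ℝ)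
      (v f : Option (Finset (Fin N)) → ℝ),
      (∀ j w, ∑ a, (A j *ᵥ w) a ^ 2 ≤ ∑ a, w a ^ 2) ∧ ∑ a, v a ^ 2 = 1 ∧ ∑ a, f a ^ 2 = 1 ∧
      f ⬝ᵥ ((∑ S : Finset (Fin N), c S • ((S.sort).map A).prod) *ᵥ v) =
        (∑ S with S.card = D, c S ^ 2) / √M := by
  classical
  -- creation amplitude and annihilation matrix entry
  set cre : Fin N → Finset (Fin N) → ℝ := fun j T =>
    if j ∉ T ∧ T.card + 1 = D then c (insert j T) / √M else 0 with hcre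
  set A : Fin N → Matrix (Option (Finset (Fin N))) (Option (Finset (Fin N))) ℝ := fun j =>
    Matrix.of fun a b => a.elim 0 fun T => b.elim (cre j T) fun T' =>
      if j ∉ T ∧ T.card + 2 ≤ D then (if T' = insert j T then 1 else 0) else 0 with hA
  set v : Option (Finset (Fin N)) → ℝ := Pi.single none 1 with hv
  set f : Option (Finset (Fin N)) → ℝ := Pi.single (some ∅) 1 with hf
  -- matrix entries (by `rfl`) and the action of `A j` on a vector
  have ent_none : ∀ j b, A j none b = 0 := fun _ _ => rfl
  have ent_cre : ∀ j T, A j (some T) none = cre j T := fun _ _ => rfl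
  have ent_ann : ∀ j T T', A j (some T) (some T') =
      if j ∉ T ∧ T.card + 2 ≤ D then (if T' = insert j T then (1 : ℝ) else 0) else 0 := fun _ _ _ => rfl
  have mv_none : ∀ j w, (A j *ᵥ w) none = 0 := by
    intro j w
    simp only [Matrix.mulVec, dotProduct, ent_none, zero_mul, Finset.sum_const_zero]
  have mv_some : ∀ j w T, (A j *ᵥ w) (some T) =
      cre j T * w none + (if j ∉ T ∧ T.card + 2 ≤ D then w (some (insert j T)) else 0) := by
    intro j w T
    simp only [Matrix.mulVec, dotProduct, Fintype.sum_option, ent_cre, ent_ann]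
    congr 1
    by_cases h : j ∉ T ∧ T.card + 2 ≤ D
    · simp only [if_pos h, ite_mul, one_mul, zero_mul, Finset.sum_ite_eq', Finset.mem_univ, if_true]
    · simp only [if_neg h, zero_mul, Finset.sum_const_zero]
  -- products of the `A j` along a list
  have prod_cons : ∀ (j : Fin N) (L : List (Fin N)) (w : Option (Finset (Fin N)) → ℝ),
      ((j :: L).map A).prod *ᵥ w = A j *ᵥ ((L.map A).prod *ᵥ w) := by
    intro j L w
    rw [List.map_cons, List.prod_cons, ← Matrix.mulVec_mulVec]
  have none_entry : ∀ (L : List (Fin N)) (w : Option (Finset (Fin N)) → ℝ), L ≠ [] →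
      ((L.map A).prod *ᵥ w) none = 0 := by
    intro L w hL
    obtain ⟨j, L', rfl⟩ := List.exists_cons_of_ne_nil hL
    rw [prod_cons, mv_none]
  have main_entry : ∀ (L : List (Fin N)), L.Nodup → L ≠ [] → ∀ T : Finset (Fin N), (∀ j ∈ L, j ∉ T) →
      ((L.map A).prod *ᵥ v) (some T) =
        if T.card + L.length = D then c (L.toFinset ∪ T) / √M else 0 := by
    intro L
    induction L with
    | nil => intro _ h; exact absurd rfl h
    | cons j L ih =>
      intro hnd _ T hT
      have hjT : j ∉ T := hT j (by simp)
      rcases eq_or_ne L [] with hL | hL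
      · subst hL
        have h1 : (([j].map A).prod *ᵥ v) (some T) = (A j *ᵥ v) (some T) := by
          simp only [List.map_cons, List.map_nil, List.prod_cons, List.prod_nil, mul_one]
        have hv0 : v (some (insert j T)) = 0 := by rw [hv]; exact Pi.single_eq_of_ne (Option.some_ne_none _) _
        have hv1 : v none = 1 := by rw [hv]; exact Pi.single_eq_same _ _
        have h2 : [j].toFinset ∪ T = insert j T := by ext k; simp
        rw [h1, mv_some, hv0, hv1, mul_one, ite_self, add_zero, h2]
        simp only [hcre, List.length_cons, List.length_nil, zero_add]
        by_cases h3 : T.card + 1 = D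
        · rw [if_pos ⟨hjT, h3⟩, if_pos h3]
        · rw [if_neg (fun h => h3 h.2), if_neg h3]
      · rw [prod_cons, mv_some, none_entry L v hL, mul_zero, zero_add]
        have hnd' : L.Nodup := (List.nodup_cons.mp hnd).2
        have hjL : j ∉ L := (List.nodup_cons.mp hnd).1
        have hT' : ∀ k ∈ L, k ∉ insert j T := by
          intro k hk
          rw [Finset.mem_insert, not_or]
          exact ⟨fun h => hjL (h ▸ hk), hT k (List.mem_cons_of_mem j hk)⟩
        rw [ih hnd' hL (insert j T) hT', Finset.card_insert_of_notMem hjT, List.length_cons,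
          List.toFinset_cons, Finset.insert_union, ← Finset.union_insert]
        have hlen : 1 ≤ L.length := List.length_pos_iff.mpr hL
        by_cases h2 : T.card + 2 ≤ D
        · rw [if_pos ⟨hjT, h2⟩]
          by_cases h3 : T.card + 1 + L.length = D
          · rw [if_pos h3, if_pos (by omega)]
          · rw [if_neg h3, if_neg (by omega)]
        · rw [if_neg (fun h => h2 h.2), if_neg (by omega)]
  refine ⟨A, v, f, ?_, ?_, ?_, ?_⟩
  · -- every `A j` is a contraction
    intro j w
    rw [Fintype.sum_option, Fintype.sum_option, mv_none]
    simp only [ne_eq, OfNat.ofNat_ne_zero, not_false_eq_true, zero_pow, zero_add]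
    -- creation and annihilation live on disjoint sets of `T` (by cardinality): no cross terms
    have hsq : ∀ T, (A j *ᵥ w) (some T) ^ 2 =
        cre j T ^ 2 * w none ^ 2 + (if j ∉ T ∧ T.card + 2 ≤ D then w (some (insert j T)) ^ 2 else 0) := by
      intro T
      rw [mv_some]
      by_cases h : j ∉ T ∧ T.card + 2 ≤ D
      · have hc : cre j T = 0 := by rw [hcre]; exact if_neg (fun h' => by omega)
        simp [h, hc]
      · simp only [h, if_false, add_zero]
        ring
    simp only [hsq, Finset.sum_add_distrib]
    have h1 : ∑ T, cre j T ^ 2 * w none ^ 2 ≤ w none ^ 2 := by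
      rw [← Finset.sum_mul]
      have hc : ∑ T, cre j T ^ 2 ≤ 1 := by
        have hcre2 : ∀ T, cre j T ^ 2 =
            if j ∉ T then (if (insert j T).card = D then c (insert j T) ^ 2 / M else 0) else 0 := by
          intro T
          by_cases hj : j ∈ T
          · have h0 : cre j T = 0 := by simp only [hcre]; rw [if_neg (fun h => h.1 hj)]
            rw [h0, if_neg (fun h => h hj)]; ring
          · rw [if_pos hj, Finset.card_insert_of_notMem hj]
            by_cases hD' : T.card + 1 = D
            · have h0 : cre j T = c (insert j T) / √M := by simp only [hcre]; rw [if_pos ⟨hj, hD'⟩]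
              rw [h0, if_pos hD', div_pow, Real.sq_sqrt hM.le]
            · have h0 : cre j T = 0 := by simp only [hcre]; rw [if_neg (fun h => hD' h.2)]
              rw [h0, if_neg hD']; ring
        simp only [hcre2]
        rw [← Finset.sum_filter, sum_filter_notMem_insert j (fun T => if T.card = D then c T ^ 2 / M else 0)]
        have hq : ∑ T with j ∈ T, (if T.card = D then c T ^ 2 / M else 0) =
            (∑ S with (S.card = D ∧ j ∈ S), c S ^ 2) / M := by
          rw [Finset.sum_div, Finset.sum_filter, Finset.sum_filter]
          refine Finset.sum_congr rfl fun T _ => ?_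
          by_cases h1 : j ∈ T <;> by_cases h2 : T.card = D <;> simp [h1, h2]
        rw [hq, div_le_one hM]
        exact hMb j
      calc (∑ T, cre j T ^ 2) * w none ^ 2 ≤ 1 * w none ^ 2 :=
            mul_le_mul_of_nonneg_right hc (sq_nonneg _)
        _ = w none ^ 2 := one_mul _
    have h2 : ∑ T, (if j ∉ T ∧ T.card + 2 ≤ D then w (some (insert j T)) ^ 2 else 0) ≤
        ∑ T, w (some T) ^ 2 := by
      calc ∑ T, (if j ∉ T ∧ T.card + 2 ≤ D then w (some (insert j T)) ^ 2 else 0)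
          ≤ ∑ T, (if j ∉ T then w (some (insert j T)) ^ 2 else 0) := by
            refine Finset.sum_le_sum fun T _ => ?_
            by_cases h : j ∉ T ∧ T.card + 2 ≤ D
            · rw [if_pos h, if_pos h.1]
            · rw [if_neg h]; split_ifs <;> positivity
        _ = ∑ T with j ∈ T, w (some T) ^ 2 := by
            rw [← Finset.sum_filter]; exact sum_filter_notMem_insert j (fun T => w (some T) ^ 2)
        _ ≤ ∑ T, w (some T) ^ 2 :=
            Finset.sum_le_sum_of_subset_of_nonneg (Finset.filter_subset _ _) fun T _ _ => sq_nonneg _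
    linarith
  · simp [hv, Pi.single_apply]
  · simp [hf, Pi.single_apply]
  · -- the pairing `⟨f_∅, p(A) v⟩`
    rw [hf, single_dotProduct, one_mul, Matrix.sum_mulVec, Finset.sum_apply]
    have hterm : ∀ S : Finset (Fin N), ((c S • ((S.sort).map A).prod) *ᵥ v) (some ∅) =
        if S.card = D then c S * c S / √M else 0 := by
      intro S
      rw [Matrix.smul_mulVec, Pi.smul_apply, smul_eq_mul]
      rcases S.eq_empty_or_nonempty with hS | hS
      · subst hS
        simp only [Finset.sort_empty, List.map_nil, List.prod_nil, Matrix.one_mulVec, Finset.card_empty]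
        rw [hv, Pi.single_apply, if_neg (Option.some_ne_none _), if_neg (by omega), mul_zero]
      · have hne : S.sort ≠ [] := by
          intro h
          have := congrArg List.length h
          rw [Finset.length_sort, List.length_nil] at this
          exact hS.ne_empty (Finset.card_eq_zero.mp this)
        rw [main_entry _ (Finset.sort_nodup _ _) hne ∅ (fun j _ => Finset.notMem_empty j),
          Finset.card_empty, zero_add, Finset.length_sort, Finset.sort_toFinset, Finset.union_empty]
        split_ifs <;> ring
    simp only [hterm]
    rw [Finset.sum_filter, Finset.sum_div]
    refine Finset.sum_congr rfl fun S _ => ?_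
    split_ifs <;> ring

end Summit.QuantumAdvantage.QuantumAdvantage.Theorems.SosSandwich.CompletelyBoundedCorner

end
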